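import Summits.CriticalPhenomena.PercolationContinuityZ3.Theorems.Transplant.SkelFrmBParamsBridgeF
import Summits.CriticalPhenomena.PercolationContinuityZ3.Theorems.Transplant.SkelPhiRootBridgeData
import HarnessLib
/-!
# N2 (frames-only node `SamePDropOfSkeletonFrm₁`, OPEN), (R) value layer — part Bridge0: **THE ROOT BRIDGE PAIR AND ITS FRAME AT THE (S0) KIT LEVELS**
# (p3-g17, 2026-08-23; lead g12 08:31:58Z: the (R)-side value rows are the p3 lineage's; design rulings (R-36)/(R-37) and (R-41) below)

The root leg of record ((R-36)) is HOP (the root's own long link) → BRIDGE (one forced-kit step at a SMALL selected pair) → K-G CORRIDOR; this file names the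
bridge and discharges the ARITHMETIC rows the first/second-axis skeletons `NegB.rootLegAt_frmQ3C_fst` / `…Q3D_snd` (p354138 / p356852) bind: `B`, `hB`, `hB0`,
`hBR'`, `hc1`, `hc1R` (as a budget `Yb0`), `hhopB`, `hclear₁` (as a width floor).  The PROBABILISTIC row `hbridge` with its readings `Qb Fb hQb hFb` is the twin
file `SkelFrmBChoiceBridge0` (at `AtQNQ`).
**(R-41) (design owner p3-g17, 2026-08-23).** (a) The bridge clearance is `(g, f)`-FREE: **`b0 mk := Rs mk + 2·R'0 mk + 2`** (`Rs` = the seed's graph radius at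
kit index `mk`, `R'0` = the (S0) kit-level displacement); the pair `(MB0, nB0) := (MB D mb0, nB D mb0 b0)`, `mb0 := max (2·b0 + 26) (24·M_u + 63)`, is drawn through
the record's selectors BEFORE the long pair, exactly as N1's `(MBR, nBR)` at `bR = k + 2·RA′ + 1` — so every floor the bridge puts on the long pair's slots
(`hclear₁`: `Rs + R'0 + prB0 + 1 ≤ f`; the cross-link/`hc1R` budgets on `g`/`ex`, next files) is a residual floor in stmt-g21's sense and nothing is circular
(hp-8 g42 08:28:33Z's located selector-order point: `RL`, the long link region's radius, does NOT enter `b0`).  (b) ONE FRAME, NOT THREE: the bridge pair and the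
long pair are both SELECTED pairs, so `FactsNS.sel_ori` (SkelFrm1Normalise :279) makes their orientation bits equal — `φB = φL` — and of N1's three bridge cases
(`bridgeSame/TrSide/TrTop`) only `bridgeSame` at `σ = 1` is live in N2 (the transposed cases would need the steep side half at near sign `sgnz h_b`, which the
frames-only Step I‴ does not serve; they are not needed).  (c) Exact landing: frames have unit steps (`Skelφ.exists_mem_graphBall_φ_eq`), so the covering slack `e`
of (R-37) is `0`; `b0` buys (R-F2′) `core1Lo 0 = n_L − R'0 + nB0 ≥ Rs + n_L + R'0 + 2`.
* §1 `KS.b0/mb0`, `MB0/nB0/hB0/ℓB0/vB0`, `prB0` (= `D.scale t MB0 nB0`), `RB0 := D.R prB0`; `b0_eq`, `mb0_floors`, **`RF2_0`**, **`MB0_floors`**, `bridge0_adm`,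
  `ℓB0_ge`, `le_prB0`; the extra-pair slot **`Px0`** with `mem_Px0`; the width residual **`fxR0 := Rs + R'0 + prB0 + 1`**.
* §2 the frame **`KS.B0 mk g f := Skelφ.bridgeSame 1 n_L h_L ℓ_L (R'0 mk) nB0 hB0 ℓB0`**: `B0_ok` (`3 ≤ ℓB0`), `B0_apply` (the six fields), `B0_lo_le_hi`, `R'0_le_B0_R'`,
  `B0_core1` (closed forms), **`hhopB_0`** (the hop's side half lands in `B₀`, ANY map), **`hclear₁_0`** (under the width floor), `Yb0` with **`core1Lo_0_l1`**.
NON-VACUITY (lead g11 standing order): definitions + arithmetic; the only geometric hypothesis is `ℓB0_ge`'s `EqGeom` at the pair, discharged at `AtQNQ` by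
`clauseP_of_atQ` in the twin file; the floor `fxR0 ≤ f` is a max-floor on the free width residual (stmt-g21's union file).
builds on p205010 (kernel theorem, internal audit signed; external expert review pending) — nothing in this file uses p205010; NOTHING is claimed about the open node
`SamePDropOfSkeletonFrm₁`.
Lane `prim-bschramm`, seat `prim-bschramm-p3` (gen 17; N2 design owner, (R) column owner); helper file (`--supports stmt-CriticalPhenomena-4575 --as helper`).
[cite: KozmaNitzan2024, §4 p. 28 ((32) at the root), Lemma 10 Step IV (pp. 20–21)] [cite: MartineauTassion2017, §3.2 Lemma 3.5]
-/

noncomputable section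

open scoped Classical

namespace Summit.CriticalPhenomena.PercolationContinuityZ3.Theorems.Transplant

namespace PlanarSkeletonFrm

namespace NegB

open Literature.Probability.Percolation Literature.Probability.LatticeModels SimpleGraph
open SkelConc (Consts)
open Skelφ (rootFrame pgSideHalfW)
open Skelφ.StepI (DataN)
open ChainPlanar (BridgePrm BridgeOK)
open Neg

namespace KS

/-! ## §1 The root bridge pair -/

section Pair

variable (κ : Consts) {V : Type} [DecidableEq V] [Countable V] {G : SimpleGraph V} [G.LocallyFinite] (Φ : PlanarSkeletonFrm G) (t : V) (p : unitInterval)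
  (D : Skelφ.StepI.DataNS V) (mk : ℕ)

/-- **The root bridge clearance** `b0 := Rs + 2·R'0 + 2` ((R-41)(a): `(g, f)`-free). [this work] -/
def b0 : ℕ := KS.Rs t D mk + 2 * KS0.R'0 κ Φ t p D mk + 2

/-- **The root bridge zone-index floor** `mb0 := max (2·b0 + 26) (24·M_u + 63)`. [this work] -/
def mb0 : ℕ := max (2 * b0 κ Φ t p D mk + 26) (24 * Mu D + 63)

/-- The root bridge zone index `MB0 := MB D mb0` (a SELECTED zone size). [this work] -/
abbrev MB0 : ℕ := MB D (mb0 κ Φ t p D mk)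

/-- The root bridge width `nB0 := nB D mb0 b0` (a SELECTED width). [this work] -/
abbrev nB0 : ℕ := nB D (mb0 κ Φ t p D mk) (b0 κ Φ t p D mk)

/-- The root bridge shear `hB0`. [this work] -/
abbrev hB0 : ℤ := hB t D (mb0 κ Φ t p D mk) (b0 κ Φ t p D mk)

/-- The root bridge half-length `ℓB0`. [this work] -/
abbrev ℓB0 : ℕ := ℓB t D (mb0 κ Φ t p D mk) (b0 κ Φ t p D mk)

/-- The root bridge split point `vB0`. [this work] -/
abbrev vB0 : ℤ := vB t D (mb0 κ Φ t p D mk) (b0 κ Φ t p D mk)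

/-- **The root bridge prism's planar radius** `prB0 := pgScale nB0 hB0 (3·ℓB0)` (= the record's link-region scale at the pair). [this work] -/
def prB0 : ℕ := Skelφ.pgScale (nB0 κ Φ t p D mk) (hB0 κ Φ t p D mk) (3 * ℓB0 κ Φ t p D mk)

/-- **The root bridge prism's fibre radius** `RB0 := D.R prB0` (the `Rb` of the skeletons). [this work] -/
def RB0 : ℕ := D.R (prB0 κ Φ t p D mk)

/-- `b0 = Rs + 2R'0 + 2`. [folklore] -/
theorem b0_eq : b0 κ Φ t p D mk = KS.Rs t D mk + 2 * KS0.R'0 κ Φ t p D mk + 2 := rfl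

/-- `2·b0 + 26 ≤ mb0` and `24·M_u + 63 ≤ mb0`. [folklore] -/
theorem mb0_floors : 2 * b0 κ Φ t p D mk + 26 ≤ mb0 κ Φ t p D mk ∧ 24 * Mu D + 63 ≤ mb0 κ Φ t p D mk := ⟨le_max_left _ _, le_max_right _ _⟩

/-- **(R-F2) at the root bridge**: `b0 ≤ nB0`, `MB0 < nB0`, `MB0 + b0 + 2 + ρz ≤ nB0`. [folklore] -/
theorem RF2_0 : b0 κ Φ t p D mk ≤ nB0 κ Φ t p D mk ∧ MB0 κ Φ t p D mk < nB0 κ Φ t p D mk ∧ MB0 κ Φ t p D mk + b0 κ Φ t p D mk + 2 + ρz D ≤ nB0 κ Φ t p D mk :=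
  ⟨(nB_facts D _ _).2.2.1, (nB_facts D _ _).2.1, (nB_facts D _ _).2.2.2⟩

/-- **The zone-index floors at the root bridge**: `2·b0 + 26 ≤ MB0`, `24·M_u + 63 ≤ MB0`, `M_u ≤ MB0`. [folklore] -/
theorem MB0_floors : 2 * b0 κ Φ t p D mk + 26 ≤ MB0 κ Φ t p D mk ∧ 24 * Mu D + 63 ≤ MB0 κ Φ t p D mk ∧ Mu D ≤ MB0 κ Φ t p D mk := by
  have h1 := (MB_facts D (mb0 κ Φ t p D mk)).2.1
  have h2 := mb0_floors κ Φ t p D mk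
  exact ⟨h2.1.trans h1, h2.2.trans h1, (MB_facts D _).1⟩

/-- **The root bridge pair is admissible.** [folklore] -/
theorem bridge0_adm : D.M₀ ≤ (MB0 κ Φ t p D mk, nB0 κ Φ t p D mk).1 ∧ D.n₁ (MB0 κ Φ t p D mk, nB0 κ Φ t p D mk).1 ≤ (MB0 κ Φ t p D mk, nB0 κ Φ t p D mk).2 :=
  bridge_adm D _ _

/-- **The root bridge pair IS a selected pair** (zone floor `max M_u mb0`, the width floor of `nB`), by `rfl` — whence `FactsNS.sel_quad/sel_ori` apply to it. [folklore] -/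
theorem bridge0_pair_eq : MB0 κ Φ t p D mk = D.sM (max (Mu D) (mb0 κ Φ t p D mk)) ∧
    nB0 κ Φ t p D mk = D.sN (max (Mu D) (mb0 κ Φ t p D mk)) (Skelφ.NegPrm.nS (D.n₁ (MB0 κ Φ t p D mk)) (MB0 κ Φ t p D mk) (b0 κ Φ t p D mk) (ρz D)) :=
  ⟨rfl, rfl⟩

/-- **`2·b0 + 27 ≤ ℓB0`** from the pair's geometric clause (any map `ψ`); in particular `3 ≤ ℓB0` and `27 ≤ ℓB0`. [folklore] -/
theorem ℓB0_ge (ψ : V → Site 2) (hE : D.EqGeom G ψ t (MB0 κ Φ t p D mk) (nB0 κ Φ t p D mk)) : 2 * b0 κ Φ t p D mk + 27 ≤ ℓB0 κ Φ t p D mk := by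
  have h1 := ℓB_ge t D (mb0 κ Φ t p D mk) (b0 κ Φ t p D mk) ψ hE
  have h2 := (mb0_floors κ Φ t p D mk).1
  show _ ≤ ℓB t D (mb0 κ Φ t p D mk) (b0 κ Φ t p D mk)
  omega

/-- `nB0 ≤ prB0` and `3·ℓB0 + |hB0| ≤ prB0`. [folklore] -/
theorem le_prB0 : nB0 κ Φ t p D mk ≤ prB0 κ Φ t p D mk ∧ 3 * ℓB0 κ Φ t p D mk + (hB0 κ Φ t p D mk).natAbs ≤ prB0 κ Φ t p D mk :=
  ⟨le_max_left _ _, le_max_right _ _⟩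

/-- `prB0` is the record's link-region scale at the root bridge pair. [folklore] -/
theorem prB0_eq_scale : prB0 κ Φ t p D mk = D.toDataN.scale t (MB0 κ Φ t p D mk) (nB0 κ Φ t p D mk) := rfl

/-- `RB0 = D.R (D.scale t MB0 nB0)`. [folklore] -/
theorem RB0_eq : RB0 κ Φ t p D mk = D.R (D.toDataN.scale t (MB0 κ Φ t p D mk) (nB0 κ Φ t p D mk)) := rfl

/-- **The width residual the root bridge asks** `fxR0 := Rs + R'0 + prB0 + 1` (floor on the long pair's width slot `f`; (g, f)-free). [this work] -/
def fxR0 : ℕ := KS.Rs t D mk + KS0.R'0 κ Φ t p D mk + prB0 κ Φ t p D mk + 1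

/-- `fxR0` unfolded. [folklore] -/
theorem fxR0_eq : fxR0 κ Φ t p D mk = KS.Rs t D mk + KS0.R'0 κ Φ t p D mk + prB0 κ Φ t p D mk + 1 := rfl

end Pair

/-- **THE EXTRA-PAIR SLOT CARRYING THE ROOT BRIDGE** `Px0 mk := {(MB0, nB0)}` (with admissibility); stmt-g21 unions it into the node tuple's `PxQ`. [this work] -/
def Px0 (mk : ℕ) : PSlot := fun κ _ _ _ _ _ Φ t p D =>
  ⟨{(MB0 κ Φ t p D mk, nB0 κ Φ t p D mk)}, fun q hq => by rw [Finset.mem_singleton] at hq; subst hq; exact bridge0_adm κ Φ t p D mk⟩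

section Slot

variable (κ : Consts) {V : Type} [DecidableEq V] [Countable V] {G : SimpleGraph V} [G.LocallyFinite] (Φ : PlanarSkeletonFrm G) (t : V) (p : unitInterval)
  (D : Skelφ.StepI.DataNS V) (mk : ℕ)

/-- The root bridge pair is in its own slot. [folklore] -/
theorem mem_Px0 : (MB0 κ Φ t p D mk, nB0 κ Φ t p D mk) ∈ (Px0 mk κ Φ t p D).1 := Finset.mem_singleton_self _

/-- The root bridge pair is in every pair slot containing `Px0 mk`'s pairs (the node tuple's `Pv ⊇ Px0 ∪ …`). [folklore] -/
theorem mem_of_Px0_subset (Pv : PSlot) (h : (Px0 mk κ Φ t p D).1 ⊆ (Pv κ Φ t p D).1) : (MB0 κ Φ t p D mk, nB0 κ Φ t p D mk) ∈ (Pv κ Φ t p D).1 :=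
  h (mem_Px0 κ Φ t p D mk)

/-- The root bridge pair is in `PR mk' Px` whenever `Px ⊇ Px0 mk` (any ledger index `mk'`). [folklore] -/
theorem mem_PR_of_Px0_subset (mk' : ℕ) (Px : PSlot) (h : (Px0 mk κ Φ t p D).1 ⊆ (Px κ Φ t p D).1) :
    (MB0 κ Φ t p D mk, nB0 κ Φ t p D mk) ∈ (PR mk' Px κ Φ t p D).1 :=
  Finset.mem_union_right _ (h (mem_Px0 κ Φ t p D mk))

end Slot

/-! ## §2 The root bridge frame (`σ = 1`, case `o_b = o_L` — the only case, (R-41)(b)) -/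

section Frame

variable (κ : Consts) {V : Type} [DecidableEq V] [Countable V] {G : SimpleGraph V} [G.LocallyFinite] (Φ : PlanarSkeletonFrm G) (t : V) (p : unitInterval)
  (D : Skelφ.StepI.DataNS V) (mk : ℕ) (g f : ℕ)

/-- **THE ROOT BRIDGE FRAME** `B0 mk g f := bridgeSame 1 n_L h_L ℓ_L (R'0 mk) nB0 hB0 ℓB0`: hop box `B₀ = {n_L} × [h_L, h_L + ℓ_L]`, siting radius `R'0`, stride
displacement `{nB0} × [hB0, hB0 + ℓB0]`, prism bound `prB0`. [this work] -/
def B0 : BridgePrm :=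
  Skelφ.bridgeSame 1 (nL κ Φ t p D g f) (hL κ Φ t p D g f) (ℓL κ Φ t p D g f) (KS0.R'0 κ Φ t p D mk) (nB0 κ Φ t p D mk) (hB0 κ Φ t p D mk) (ℓB0 κ Φ t p D mk)

/-- `B0` unfolds (by `rfl`). [folklore] -/
theorem B0_eq : B0 κ Φ t p D mk g f =
    Skelφ.bridgeSame 1 (nL κ Φ t p D g f) (hL κ Φ t p D g f) (ℓL κ Φ t p D g f) (KS0.R'0 κ Φ t p D mk) (nB0 κ Φ t p D mk) (hB0 κ Φ t p D mk) (ℓB0 κ Φ t p D mk) := rfl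

/-- **The six fields of `B0`** (coordinatewise): `B₀lo = (n_L, h_L)`, `B₀hi = (n_L, h_L + ℓ_L)`, `R′ = R'0`, `dlo = (nB0, hB0)`, `dhi = (nB0, hB0 + ℓB0)`, `pr = prB0`. [folklore] -/
theorem B0_apply : (B0 κ Φ t p D mk g f).B₀lo 0 = nL κ Φ t p D g f ∧ (B0 κ Φ t p D mk g f).B₀lo 1 = hL κ Φ t p D g f ∧
    (B0 κ Φ t p D mk g f).B₀hi 0 = nL κ Φ t p D g f ∧ (B0 κ Φ t p D mk g f).B₀hi 1 = hL κ Φ t p D g f + ℓL κ Φ t p D g f ∧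
    (B0 κ Φ t p D mk g f).R' = KS0.R'0 κ Φ t p D mk ∧
    (B0 κ Φ t p D mk g f).dlo 0 = nB0 κ Φ t p D mk ∧ (B0 κ Φ t p D mk g f).dlo 1 = hB0 κ Φ t p D mk ∧
    (B0 κ Φ t p D mk g f).dhi 0 = nB0 κ Φ t p D mk ∧ (B0 κ Φ t p D mk g f).dhi 1 = hB0 κ Φ t p D mk + ℓB0 κ Φ t p D mk ∧
    (B0 κ Φ t p D mk g f).pr = prB0 κ Φ t p D mk := by
  refine ⟨?_, ?_, ?_, ?_, rfl, ?_, ?_, ?_, ?_, rfl⟩ <;> simp [B0, Skelφ.bridgeSame]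

/-- **`hB`**: `B0` is admissible (`3 ≤ ℓB0`). [folklore] -/
theorem B0_ok (hℓ : 3 ≤ ℓB0 κ Φ t p D mk) : BridgeOK (B0 κ Φ t p D mk g f) :=
  (Skelφ.bridgeOK_all (σ := 1) (Or.inl rfl) _ _ _ _ _ _ hℓ).1

/-- **`hB0`**: the hop box is nonempty, `B₀lo ≤ B₀hi`. [folklore] -/
theorem B0_lo_le_hi : (B0 κ Φ t p D mk g f).B₀lo ≤ (B0 κ Φ t p D mk g f).B₀hi := by
  obtain ⟨e0, e1, e2, e3, -⟩ := B0_apply κ Φ t p D mk g f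
  intro i
  fin_cases i
  · show (B0 κ Φ t p D mk g f).B₀lo 0 ≤ (B0 κ Φ t p D mk g f).B₀hi 0
    rw [e0, e2]
  · show (B0 κ Φ t p D mk g f).B₀lo 1 ≤ (B0 κ Φ t p D mk g f).B₀hi 1
    rw [e1, e3]
    have : (0 : ℤ) ≤ (ℓL κ Φ t p D g f : ℤ) := by positivity
    linarith

/-- **`hBR'`**: `R'0 ≤ B0.R′` (equality). [folklore] -/
theorem R'0_le_B0_R' : KS0.R'0 κ Φ t p D mk ≤ (B0 κ Φ t p D mk g f).R' := le_rfl

/-- **`hc1`**: the core-`1` box is nonempty (`3 ≤ ℓB0`). [folklore] -/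
theorem B0_core1_le (hℓ : 3 ≤ ℓB0 κ Φ t p D mk) : (B0 κ Φ t p D mk g f).core1Lo ≤ (B0 κ Φ t p D mk g f).core1Hi :=
  ChainPlanar.BridgePrm.core1Lo_le_core1Hi (B0_ok κ Φ t p D mk g f hℓ)

/-- **The core-`1` box in closed form**: `core1Lo = (n_L − R'0 + nB0, h_L − R'0 + hB0)`, `core1Hi = (n_L + R'0 + nB0, h_L + ℓ_L + R'0 + hB0 + ℓB0)`. [folklore] -/
theorem B0_core1 : (B0 κ Φ t p D mk g f).core1Lo 0 = (nL κ Φ t p D g f : ℤ) - KS0.R'0 κ Φ t p D mk + nB0 κ Φ t p D mk ∧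
    (B0 κ Φ t p D mk g f).core1Lo 1 = hL κ Φ t p D g f - KS0.R'0 κ Φ t p D mk + hB0 κ Φ t p D mk ∧
    (B0 κ Φ t p D mk g f).core1Hi 0 = (nL κ Φ t p D g f : ℤ) + KS0.R'0 κ Φ t p D mk + nB0 κ Φ t p D mk ∧
    (B0 κ Φ t p D mk g f).core1Hi 1 = hL κ Φ t p D g f + ℓL κ Φ t p D g f + KS0.R'0 κ Φ t p D mk + (hB0 κ Φ t p D mk + ℓB0 κ Φ t p D mk) := by
  obtain ⟨e0, e1, e2, e3, eR, d0, d1, d2, d3, -⟩ := B0_apply κ Φ t p D mk g f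
  refine ⟨?_, ?_, ?_, ?_⟩
  · simp only [ChainPlanar.BridgePrm.core1Lo_apply, e0, eR, d0]
  · simp only [ChainPlanar.BridgePrm.core1Lo_apply, e1, eR, d1]
  · simp only [ChainPlanar.BridgePrm.core1Hi_apply, e2, eR, d2]
  · simp only [ChainPlanar.BridgePrm.core1Hi_apply, e3, eR, d3, add_assoc]

/-- **`hhopB`**: THE HOP'S SIDE HALF LANDS IN `B₀` — for ANY planar map `φ` and kit radius `R`, the side half `pgSideHalfW G φ t n_L h_L ℓ_L R 1 1` read in the root frame
`rootFrame φ t 1` lies in `[B₀lo, B₀hi] = {n_L} × [h_L, h_L + ℓ_L]` (`1 ≤ n_L`). [cite: MartineauTassion2017, §3.2 (L(a,u), L(u,b))] -/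
theorem hhopB_0 (φ : V → Site 2) (R : ℕ) (hn : 1 ≤ nL κ Φ t p D g f) :
    ∀ w ∈ pgSideHalfW G φ t (nL κ Φ t p D g f) (hL κ Φ t p D g f) (ℓL κ Φ t p D g f) R 1 (1 * 1),
      rootFrame φ t 1 w ∈ Finset.Icc (B0 κ Φ t p D mk g f).B₀lo (B0 κ Φ t p D mk g f).B₀hi := by
  intro w hw
  rw [one_mul] at hw
  have h := Skelφ.rootFrame_mem_box_of_sideHalf (G := G) (φ := φ) t (σ := 1) hn (Or.inl rfl) hw
  have h0 : rootFrame φ t 1 t = 0 := by funext i; fin_cases i <;> simp [Skelφ.rootFrame]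
  have hℓ0 : (0 : ℤ) ≤ (ℓL κ Φ t p D g f : ℤ) := by positivity
  simp only [h0, zero_add, one_mul, min_eq_left hℓ0, max_eq_right hℓ0, add_zero] at h
  have elo : (B0 κ Φ t p D mk g f).B₀lo = Skelφ.pt (nL κ Φ t p D g f : ℤ) (hL κ Φ t p D g f) := by
    show Skelφ.pt _ (1 * hL κ Φ t p D g f) = _; rw [one_mul]
  have ehi : (B0 κ Φ t p D mk g f).B₀hi = Skelφ.pt (nL κ Φ t p D g f : ℤ) (hL κ Φ t p D g f + ℓL κ Φ t p D g f) := by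
    show Skelφ.pt _ (1 * hL κ Φ t p D g f + _) = _; rw [one_mul]
  rw [elo, ehi]
  exact h

/-- **`hclear₁`** (= (R-F1): the bridge step's region clears the seed): `Rs < B₀lo 0 − R′ − pr = n_L − R'0 − prB0`, under the width floor `fxR0 ≤ n_L`
(served as `fxR0 ≤ f ≤ n_L g f`). [folklore] -/
theorem hclear₁_0 (hf : fxR0 κ Φ t p D mk ≤ nL κ Φ t p D g f) :
    ((KS.Rs t D mk : ℕ) : ℤ) < (B0 κ Φ t p D mk g f).B₀lo 0 - (B0 κ Φ t p D mk g f).R' - (B0 κ Φ t p D mk g f).pr := by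
  obtain ⟨e0, -, -, -, eR, -, -, -, -, epr⟩ := B0_apply κ Φ t p D mk g f
  rw [e0, eR, epr]
  rw [fxR0_eq] at hf
  have h : ((KS.Rs t D mk + KS0.R'0 κ Φ t p D mk + prB0 κ Φ t p D mk + 1 : ℕ) : ℤ) ≤ (nL κ Φ t p D g f : ℤ) := by exact_mod_cast hf
  push_cast at h
  linarith

/-- `hclear₁` from the slot floor `fxR0 ≤ f` (`f ≤ n_L g f` always). [folklore] -/
theorem hclear₁_0_of_floor (hf : fxR0 κ Φ t p D mk ≤ f) :
    ((KS.Rs t D mk : ℕ) : ℤ) < (B0 κ Φ t p D mk g f).B₀lo 0 - (B0 κ Φ t p D mk g f).R' - (B0 κ Φ t p D mk g f).pr :=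
  hclear₁_0 κ Φ t p D mk g f (hf.trans (n₁L_le_nL κ Φ t p D g f).2)

/-- **The core-`1` reach budget** `Yb0 := n_L + |h_L| + 2·R'0 + nB0 + |hB0|` (≥ `‖core1Lo‖₁`; the skeleton's `hc1R` becomes the floor `Yb0 ≤ Rπ`). [this work] -/
def Yb0 : ℕ := nL κ Φ t p D g f + (hL κ Φ t p D g f).natAbs + 2 * KS0.R'0 κ Φ t p D mk + nB0 κ Φ t p D mk + (hB0 κ Φ t p D mk).natAbs

/-- **`‖core1Lo‖₁ ≤ Yb0`.** [folklore] -/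
theorem core1Lo_0_l1 : ((B0 κ Φ t p D mk g f).core1Lo 0).natAbs + ((B0 κ Φ t p D mk g f).core1Lo 1).natAbs ≤ Yb0 κ Φ t p D mk g f := by
  obtain ⟨c0, c1, -, -⟩ := B0_core1 κ Φ t p D mk g f
  have key : ∀ a b : ℤ, |a| + |b| ≤ (Yb0 κ Φ t p D mk g f : ℤ) → a.natAbs + b.natAbs ≤ Yb0 κ Φ t p D mk g f := fun a b h => by
    have : ((a.natAbs + b.natAbs : ℕ) : ℤ) ≤ (Yb0 κ Φ t p D mk g f : ℤ) := by push_cast [Int.natCast_natAbs]; exact h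
    exact_mod_cast this
  refine key _ _ ?_
  rw [c0, c1]
  have hY : (Yb0 κ Φ t p D mk g f : ℤ) = (nL κ Φ t p D g f : ℤ) + |hL κ Φ t p D g f| + 2 * KS0.R'0 κ Φ t p D mk + nB0 κ Φ t p D mk + |hB0 κ Φ t p D mk| := by
    unfold Yb0; push_cast [Int.natCast_natAbs]; ring
  rw [hY]
  have hn : (0 : ℤ) ≤ (nL κ Φ t p D g f : ℤ) := by positivity
  have hR : (0 : ℤ) ≤ (KS0.R'0 κ Φ t p D mk : ℤ) := by positivity
  have hb : (0 : ℤ) ≤ (nB0 κ Φ t p D mk : ℤ) := by positivity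
  have h1 : |(nL κ Φ t p D g f : ℤ) - KS0.R'0 κ Φ t p D mk + nB0 κ Φ t p D mk| ≤ (nL κ Φ t p D g f : ℤ) + KS0.R'0 κ Φ t p D mk + nB0 κ Φ t p D mk :=
    abs_le.2 ⟨by linarith, by linarith⟩
  have h2 : |hL κ Φ t p D g f - KS0.R'0 κ Φ t p D mk + hB0 κ Φ t p D mk| ≤ |hL κ Φ t p D g f| + KS0.R'0 κ Φ t p D mk + |hB0 κ Φ t p D mk| := by
    have a1 := le_abs_self (hL κ Φ t p D g f)
    have a2 := neg_abs_le (hL κ Φ t p D g f)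
    have a3 := le_abs_self (hB0 κ Φ t p D mk)
    have a4 := neg_abs_le (hB0 κ Φ t p D mk)
    exact abs_le.2 ⟨by linarith, by linarith⟩
  linarith

/-- **(R-F2′) in the numbers**: `core1Lo 0 = n_L − R'0 + nB0 ≥ Rs + n_L + R'0 + 2` (from `b0 ≤ nB0`). [folklore] -/
theorem core1Lo_0_ge : ((KS.Rs t D mk : ℕ) : ℤ) + nL κ Φ t p D g f + KS0.R'0 κ Φ t p D mk + 2 ≤ (B0 κ Φ t p D mk g f).core1Lo 0 := by
  obtain ⟨c0, -, -, -⟩ := B0_core1 κ Φ t p D mk g f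
  rw [c0]
  have h := (RF2_0 κ Φ t p D mk).1
  rw [b0_eq] at h
  have h' : ((KS.Rs t D mk + 2 * KS0.R'0 κ Φ t p D mk + 2 : ℕ) : ℤ) ≤ (nB0 κ Φ t p D mk : ℤ) := by exact_mod_cast h
  push_cast at h'
  linarith

end Frame

end KS

end NegB

end PlanarSkeletonFrm

end Summit.CriticalPhenomena.PercolationContinuityZ3.Theorems.Transplant

end
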